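import Summits.QuantumFields.BalabanUV.Beta.GAN24.DerivativeRateTransferJensenMassFreeKarcherContraction
import Summits.QuantumFields.BalabanUV.Beta.GAN24.DerivativeRateTransferJensenMassFreeConventionEnd

/-!
# `BalabanUV.Beta.GAN24.DerivativeRateTransferJensenMassFreeKarcherEquation` — binder row G-an2-4 ∕ (CONV-C), route R6 «VALUES, NOT DERIVATIVES», PART 77:
# THE KARCHER BASE OF NEARBY TRANSPORTS — for orthogonal transports `τ_x` whose loops `τ_xτ₀ᵀ` are within `D ≤ 1∕200` of `1` there is EXACTLY ONE orthogonal
# base `V` near `τ₀` solving Bałaban–Jaffe's (1.29) `Σ_x q_x•log(τ_xVᵀ) = 0` (skew small logarithms of size `≤ 8D`, `‖Vτ₀ᵀ − 1‖ ≤ 8D`); EVERY polar link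
# `R′` (1.26) satisfies `‖R′ − V‖ ≤ 1280D³ + 200704D⁴`, so all three printed conventions (1.26) ∕ (1.27)–(1.29) ∕ (1.28) agree to THIRD order in the loop
# letter, and PART 56's transfer letter `hτ` holds for the (1.27) pair (unit b2b-balaban-gan24-p3, gen 46; v1)

NOT IN PRINT; OUR PROOF (for the ROUTE; PART 76 `exists_karcher` ∕ `karcher_unique` ∕ `karcher_norm_le` ∕ `karcher_log_norm_le` BY NAME, skewness by
uniqueness, PART 68 `frob_norm_polar_sub_base_le`, PART 69 `exists_skew_logs_of_transports` ∕ `exists_skew_log_of_orthogonal`, PART 70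
`exists_polar_and_expMeanLink_of_transports`; [folklore] the Riemannian centre of mass of a compact Lie group BY NAME).  HONEST FRAMING (cell contract,
verbatim): «discharging `BetaPertH` makes Bałaban's UV stability UNCONDITIONAL — a real constructive-QFT result; it is NOT the continuum limit and NOT the Clay
problem.»  HONEST DEPENDENCY (verbatim): «continuum YM on T⁴ ⇐ BetaPertH ∧ nine spine estimates (0/9 proved); BetaPertH ⇐ (D1) ∧ (D4) ∧ CAP+tail; G-an2-4
gates asym, D1 and NE2/3/4.»

WHY THIS FILE.  PART 76 solves the Karcher equation abstractly (`exp(C_x) = exp(A_x)exp(−B)`, `Σ_x q_x•C_x = 0`) in any complete normed `ℝ`-algebra.  For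
real orthogonal transports `τ_x = exp(A_x)τ₀` (PART 69) the solution is Bałaban–Jaffe's `V` of (1.27) ∕ (1.29) [Erice 1985 p. 221]: (§1) **`karcher_skew`** — the
pair `(−Bᵀ, −C_xᵀ)` is a second solution in the window (`exp(−Cᵀ) = exp(A)exp(Bᵀ)` for skew `A`), so PART 76's uniqueness forces `B` and every `C_x` to be
SKEW, hence `V := exp(B)τ₀` is ORTHOGONAL and `exp(C_x)V = τ_x`; (§2) **`exists_karcher_base_of_transports`** (`D ≤ 1∕200`: `A_x` of size `2D ≤ 1∕100`,
`‖B‖ ≤ 2‖Ā‖ ≤ 4D`, `‖C_x‖ ≤ ‖A_x‖ + (3∕2)‖B‖ ≤ 8D`, `‖Vτ₀ᵀ − 1‖ = ‖exp B − 1‖ ≤ 8D`); (§3) **`karcher_base_unique`** — two orthogonal bases within `1∕100`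
of `τ₀` solving (1.29) with small logarithms coincide («if the contour variables are close to each other, then `V` is uniquely defined», typed with radii);
(§4) **`frob_norm_polar_sub_karcher_le`** (PART 68 at the base `V`: `‖R′ − V‖ ≤ (5∕2)s³ + 49s⁴`), **`karcher_base_of_transports`** (`s = 8D`:
`‖R′ − V‖ ≤ 1280D³ + 200704D⁴`), **`exists_polar_near_karcher`** (with PART 70: `‖R′ − exp(Σq•A)τ₀‖ ≤ 20D³ + 784D⁴`, hence
`‖exp(Σq•A)τ₀ − V‖ ≤ 1300D³ + 201488D⁴` — (1.26), (1.27), (1.28) pairwise third order); (§5) **`transferLetter_karcher_of_transports`** — the bond-indexed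
letter `|(V(e′) − R′(e′))w|² ≤ (1280D³ + 200704D⁴)²|w|²`, PART 56's `hτ` for the (1.27) pair.

HONEST SCOPE.  Crude windows and constants (`D ≤ 1∕200`; `8D`; `1280, 200704` = `(5∕2)·8³, 49·8⁴`); the reference `τ₀` is any orthogonal matrix with the
loop letter (print: the central contour `U(yy′)`); `V` and the logarithms in the full orthogonal group ∕ its Lie algebra (U(N) via PART 65 ∕ 73's commutant
argument is one `refine` away, SU(N)'s det phase not addressed); that `V` MINIMISES Federbush's `d` is PART 80 (the Gauss lemma, PARTs 78 ∕ 79); ONE scale;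
nothing of Bałaban's `Ū ∕ G_k ∕ Δ_k` instantiated; NOT the tower, NOT (CONS), NOT (CONV-C).

WHAT THIS FILE PROVES (0 sorry, 0 `def`, nothing cited): §1 `exp_neg_mul_exp`, `exp_neg_transpose_log`, **`karcher_skew`**; §2 **`exists_karcher_base_of_transports`**;
§3 **`karcher_base_unique`**; §4 **`frob_norm_polar_sub_karcher_le`**, `eight_mul_cube_eq`, **`karcher_base_of_transports`**, **`exists_polar_near_karcher`**;
§5 **`transferLetter_karcher_of_transports`**.
SUPPLIER work on route R6 (rank 2, REDUCTION, no seat); no consumer of record; NEVER «G-an2-4 closed»; NOT (CONV-C), NOT D1, NOT `BetaPertH`, NOT continuum,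
NOT Clay.  Records: `HOME/b2b-balaban-gan24-p3/WOODBURY-FIBRE.md` v14.6, `HOME/beta/ROUTES-GAN24.md` v60 §3, `HOME/b2b-balaban-gan24-refuter/PRICING-GAN24.md`
v3.59 (R6 row l.507). -/

noncomputable section

open scoped Matrix Matrix.Norms.Frobenius NNReal
open NormedSpace Finset Matrix Metric Set

namespace Summit.QuantumFields.BalabanUV.Beta.GAN24.DerivativeRateTransferJensenMassFreeKarcherEquation

open Summit.QuantumFields.BalabanUV.Beta.GAN24.DerivativeRateTransferJensenMassFreePolarNear
open Summit.QuantumFields.BalabanUV.Beta.GAN24.DerivativeRateTransferJensenMassFreeExpTaylor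
open Summit.QuantumFields.BalabanUV.Beta.GAN24.DerivativeRateTransferJensenMassFreeConvention
open Summit.QuantumFields.BalabanUV.Beta.GAN24.DerivativeRateTransferJensenMassFreeLogarithm
open Summit.QuantumFields.BalabanUV.Beta.GAN24.DerivativeRateTransferJensenMassFreeConventionEnd
open Summit.QuantumFields.BalabanUV.Beta.GAN24.DerivativeRateTransferJensenMassFreeKarcherContraction

variable {o ν : Type*} [Fintype o] [DecidableEq o] [Fintype ν]

/-! ## §1 Skewness by uniqueness -/

omit [Fintype ν] in
/-- `exp(−X)·exp(X) = 1`. [folklore] -/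
theorem exp_neg_mul_exp (X : Matrix o o ℝ) : exp (-X) * exp X = 1 := by
  rw [← Matrix.exp_add_of_commute (-X) X (Commute.neg_left (Commute.refl X)), neg_add_cancel, exp_zero]

omit [Fintype ν] in
/-- **the transposed candidate**: `A` skew and `exp C = exp A · exp(−B)` ⟹ `exp(−Cᵀ) = exp A · exp(−(−Bᵀ))` (`exp(Cᵀ) = exp(−Bᵀ)·exp(−A)` has the two-sided
inverse `exp(−Cᵀ)` and the right inverse `exp A · exp(Bᵀ)`). [folklore] -/
theorem exp_neg_transpose_log {A B C : Matrix o o ℝ} (hA : Aᵀ = -A) (hCe : exp C = exp A * exp (-B)) :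
    exp (-Cᵀ) = exp A * exp (-(-Bᵀ)) := by
  have h1 : exp Cᵀ = exp (-Bᵀ) * exp (-A) := by
    rw [Matrix.exp_transpose, hCe, transpose_mul, ← Matrix.exp_transpose, ← Matrix.exp_transpose, transpose_neg, hA]
  have h2 : exp Cᵀ * (exp A * exp (-(-Bᵀ))) = 1 := by
    rw [h1, Matrix.mul_assoc, ← Matrix.mul_assoc (exp (-A)), exp_neg_mul_exp, Matrix.one_mul, neg_neg,
      ← Matrix.exp_add_of_commute (-Bᵀ) Bᵀ (Commute.neg_left (Commute.refl _)), neg_add_cancel, exp_zero]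
  calc exp (-Cᵀ) = exp (-Cᵀ) * (exp Cᵀ * (exp A * exp (-(-Bᵀ)))) := by rw [h2, Matrix.mul_one]
    _ = (exp (-Cᵀ) * exp Cᵀ) * (exp A * exp (-(-Bᵀ))) := by rw [Matrix.mul_assoc]
    _ = exp A * exp (-(-Bᵀ)) := by rw [exp_neg_mul_exp, Matrix.one_mul]

/-- **`karcher_skew` — THE SOLUTION AND ITS LOGARITHMS ARE SKEW** [our proof]: skew data `A_x` (`‖A_x‖ ≤ 1∕100`), a solution `B` (`‖B‖ ≤ 1∕50`) with small
logarithms `C_x` of `exp(A_x)exp(−B)` and `Σ_x q_x•C_x = 0` ⟹ `Bᵀ = −B` and every `C_xᵀ = −C_x`: the pair `(−Bᵀ, −C_xᵀ)` is a second solution in the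
window, so PART 76's uniqueness applies. -/
theorem karcher_skew {q : ν → ℝ} (hq : ∀ x, 0 ≤ q x) (hq1 : ∑ x, q x = 1) {A : ν → Matrix o o ℝ} (hAt : ∀ x, (A x)ᵀ = -A x)
    (hA : ∀ x, ‖A x‖ ≤ 1 / 100) {B : Matrix o o ℝ} (hB : ‖B‖ ≤ 1 / 50) {C : ν → Matrix o o ℝ} (hC : ∀ x, ‖C x‖ ≤ 1 / 4)
    (hCe : ∀ x, exp (C x) = exp (A x) * exp (-B)) (h0 : ∑ x, q x • C x = 0) : Bᵀ = -B ∧ ∀ x, (C x)ᵀ = -C x := by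
  have hB' : ‖-Bᵀ‖ ≤ 1 / 50 := by rw [norm_neg, Matrix.frobenius_norm_transpose]; exact hB
  have hC' : ∀ x, ‖-(C x)ᵀ‖ ≤ 1 / 4 := fun x => by rw [norm_neg, Matrix.frobenius_norm_transpose]; exact hC x
  have hC'e : ∀ x, exp (-(C x)ᵀ) = exp (A x) * exp (-(-Bᵀ)) := fun x => exp_neg_transpose_log (hAt x) (hCe x)
  have h0' : ∑ x, q x • (-(C x)ᵀ) = 0 := by
    have h : (∑ x, q x • C x)ᵀ = 0 := by rw [h0, transpose_zero]
    rw [transpose_sum] at h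
    rw [← neg_eq_zero, ← Finset.sum_neg_distrib, ← h]
    exact Finset.sum_congr rfl fun x _ => by rw [transpose_smul, smul_neg, neg_neg]
  have hBB := karcher_unique hq hq1 hA hB hB' hC hC' hCe hC'e h0 h0'
  have hBt : Bᵀ = -B := by
    have h := congrArg Matrix.transpose hBB
    rwa [transpose_neg, transpose_transpose] at h
  refine ⟨hBt, fun x => ?_⟩
  have e1 : exp (A x) * exp (-B) = exp (A x) * exp (-(-Bᵀ)) := by rw [← hBB]
  -- (the exponential equations coming from PART 76 are elaborated along the generic normed-algebra instance path: chain them by `Eq.trans`,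
  -- which unifies up to definitional equality, never by `rw`)
  have h : C x = -(C x)ᵀ := log_unique (hC x) (hC' x) ((hCe x).trans (e1.trans (hC'e x).symm))
  rw [eq_comm, neg_eq_iff_eq_neg] at h
  exact h

/-! ## §2 The Karcher base of nearby transports (existence) -/

/-- **`exists_karcher_base_of_transports` — BAŁABAN–JAFFE's (1.29) SOLVED NEAR THE TRANSPORTS** [our proof]: weights `q ≥ 0`, `Σq = 1`, orthogonal transports
`τ_x` and an orthogonal reference `τ₀` with `‖τ_x·τ₀ᵀ − 1‖ ≤ D ≤ 1∕200` (Frobenius) ⟹ there is an ORTHOGONAL base `V` with `‖V·τ₀ᵀ − 1‖ ≤ 8D` and SKEW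
logarithms `C_x` with `exp(C_x)·V = τ_x`, `‖C_x‖ ≤ 8D`, and `Σ_x q_x•C_x = 0` — the KARCHER EQUATION `Σ_x q_x•log(τ_xVᵀ) = 0` at `V`. -/
theorem exists_karcher_base_of_transports {q : ν → ℝ} (hq : ∀ x, 0 ≤ q x) (hq1 : ∑ x, q x = 1) {τ : ν → Matrix o o ℝ}
    {τ₀ : Matrix o o ℝ} (hτ : ∀ x, (τ x)ᵀ * τ x = 1) (hτ₀ : τ₀ᵀ * τ₀ = 1) {D : ℝ} (hD : ∀ x, ‖τ x * τ₀ᵀ - 1‖ ≤ D)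
    (hD200 : D ≤ 1 / 200) :
    ∃ (V : Matrix o o ℝ) (C : ν → Matrix o o ℝ), Vᵀ * V = 1 ∧ ‖V * τ₀ᵀ - 1‖ ≤ 8 * D ∧ (∀ x, (C x)ᵀ = -C x) ∧
      (∀ x, exp (C x) * V = τ x) ∧ (∀ x, ‖C x‖ ≤ 8 * D) ∧ ∑ x, q x • C x = 0 := by
  obtain ⟨A, hAt, hA2, -, hAe⟩ := exists_skew_logs_of_transports hτ hτ₀ hD (by linarith)
  have hA : ∀ x, ‖A x‖ ≤ 1 / 100 := fun x => (hA2 x).trans (by linarith)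
  obtain ⟨B, hB, C, hC, hCe', h0⟩ := exists_karcher hq hq1 hA
  -- re-ascribe along this file's instance path (definitionally equal), so that `rw` applies below
  have hCe : ∀ x, exp (C x) = exp (A x) * exp (-B) := hCe'
  obtain ⟨hBt, hCt⟩ := karcher_skew hq hq1 hAt hA hB hC hCe h0
  have hAbar : ‖∑ x, q x • A x‖ ≤ 2 * D := norm_wmean_le hq hq1 hA2
  have hBn : ‖B‖ ≤ 4 * D := (karcher_norm_le hq hq1 hA hB hC hCe h0).trans (by linarith)
  refine ⟨exp B * τ₀, C, ?_, ?_, hCt, fun x => ?_, fun x => ?_, h0⟩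
  · rw [transpose_mul, Matrix.mul_assoc, ← Matrix.mul_assoc (exp B)ᵀ, orthogonal_exp_of_skew hBt, Matrix.one_mul, hτ₀]
  · rw [Matrix.mul_assoc, mul_eq_one_comm.mp hτ₀, Matrix.mul_one]
    exact (norm_exp_sub_one_le B (hB.trans (by norm_num))).trans (by linarith)
  · rw [hCe x, Matrix.mul_assoc, ← Matrix.mul_assoc (exp (-B)), exp_neg_mul_exp, Matrix.one_mul, hAe x]
  · exact (karcher_log_norm_le (hA x) hB (hC x) (hCe x)).trans (by linarith [hA2 x])

/-! ## §3 Uniqueness of the Karcher base («V is uniquely defined», typed with radii) -/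

/-- **`karcher_base_unique` — AT MOST ONE KARCHER BASE NEAR THE TRANSPORTS** [our proof]: transports within `D ≤ 1∕200` of `τ₀`; two orthogonal bases `V, V′`
within `1∕100` of `τ₀` (`‖V·τ₀ᵀ − 1‖ ≤ 1∕100`), each with small logarithms (`‖·‖ ≤ 1∕4`) `exp(C_x)·V = τ_x`, `exp(C′_x)·V′ = τ_x` of weighted mean zero, coincide. -/
theorem karcher_base_unique {q : ν → ℝ} (hq : ∀ x, 0 ≤ q x) (hq1 : ∑ x, q x = 1) {τ : ν → Matrix o o ℝ} {τ₀ : Matrix o o ℝ}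
    (hτ : ∀ x, (τ x)ᵀ * τ x = 1) (hτ₀ : τ₀ᵀ * τ₀ = 1) {D : ℝ} (hD : ∀ x, ‖τ x * τ₀ᵀ - 1‖ ≤ D) (hD200 : D ≤ 1 / 200)
    {V V' : Matrix o o ℝ} (hV : Vᵀ * V = 1) (hV' : V'ᵀ * V' = 1) (hV1 : ‖V * τ₀ᵀ - 1‖ ≤ 1 / 100) (hV'1 : ‖V' * τ₀ᵀ - 1‖ ≤ 1 / 100)
    {C C' : ν → Matrix o o ℝ} (hC : ∀ x, ‖C x‖ ≤ 1 / 4) (hC' : ∀ x, ‖C' x‖ ≤ 1 / 4) (hCe : ∀ x, exp (C x) * V = τ x)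
    (hC'e : ∀ x, exp (C' x) * V' = τ x) (h0 : ∑ x, q x • C x = 0) (h0' : ∑ x, q x • C' x = 0) : V = V' := by
  obtain ⟨A, -, hA2, -, hAe⟩ := exists_skew_logs_of_transports hτ hτ₀ hD (by linarith)
  have hA : ∀ x, ‖A x‖ ≤ 1 / 100 := fun x => (hA2 x).trans (by linarith)
  have hτ₀' : τ₀ * τ₀ᵀ = 1 := mul_eq_one_comm.mp hτ₀
  -- the logarithms of `Vτ₀ᵀ`, `V′τ₀ᵀ`
  have horth : ∀ W : Matrix o o ℝ, Wᵀ * W = 1 → (W * τ₀ᵀ)ᵀ * (W * τ₀ᵀ) = 1 := fun W hW => by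
    rw [transpose_mul, transpose_transpose, Matrix.mul_assoc, ← Matrix.mul_assoc Wᵀ, hW, Matrix.one_mul, hτ₀']
  obtain ⟨B, hBt, -, hB2, hBe⟩ := exists_skew_log_of_orthogonal (horth V hV) (hV1.trans (by norm_num))
  obtain ⟨B', hB't, -, hB'2, hB'e⟩ := exists_skew_log_of_orthogonal (horth V' hV') (hV'1.trans (by norm_num))
  have hB : ‖B‖ ≤ 1 / 50 := hB2.trans (by linarith)
  have hB' : ‖B'‖ ≤ 1 / 50 := hB'2.trans (by linarith)
  have hVB : ∀ {W Bw : Matrix o o ℝ}, exp Bw = W * τ₀ᵀ → W = exp Bw * τ₀ := fun h => by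
    rw [h, Matrix.mul_assoc, hτ₀, Matrix.mul_one]
  have key : ∀ {W Bw : Matrix o o ℝ} {Cw : ν → Matrix o o ℝ}, Wᵀ * W = 1 → Bwᵀ = -Bw → exp Bw = W * τ₀ᵀ →
      (∀ x, exp (Cw x) * W = τ x) → ∀ x, exp (Cw x) = exp (A x) * exp (-Bw) := by
    intro W Bw Cw hW hBwt hBwe hCwe x
    have hWW : W * Wᵀ = 1 := mul_eq_one_comm.mp hW
    calc exp (Cw x) = exp (Cw x) * W * Wᵀ := by rw [Matrix.mul_assoc, hWW, Matrix.mul_one]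
      _ = exp (A x) * τ₀ * (exp Bw * τ₀)ᵀ := by rw [hCwe x, ← hAe x, ← hVB hBwe]
      _ = exp (A x) * exp (-Bw) := by
        rw [transpose_mul, transpose_exp_of_skew hBwt, Matrix.mul_assoc, ← Matrix.mul_assoc τ₀, hτ₀', Matrix.one_mul]
  have hBB := karcher_unique hq hq1 hA hB hB' hC hC' (key hV hBt hBe hCe) (key hV' hB't hB'e hC'e) h0 h0'
  rw [hVB hBe, hVB hB'e, hBB]

/-! ## §4 The polar link against the Karcher base -/

/-- **`frob_norm_polar_sub_karcher_le` — (1.26) AGAINST (1.27)∕(1.29)** [PART 68 `frob_norm_polar_sub_base_le` at the Karcher base]: an orthogonal base `V`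
with skew logarithms `exp(C_x)·V = τ_x`, `‖C_x‖ ≤ s ≤ 1`, `Σ_x q_x•C_x = 0` ⟹ every orthogonal `R′` with `(Σ_x q_x•τ_x)·R′ᵀ` symmetric positive
semidefinite (a polar link) satisfies `‖R′ − V‖ ≤ (5∕2)s³ + 49s⁴`. -/
theorem frob_norm_polar_sub_karcher_le {q : ν → ℝ} (hq : ∀ x, 0 ≤ q x) (hq1 : ∑ x, q x = 1) {V : Matrix o o ℝ} (hV : Vᵀ * V = 1)
    {C : ν → Matrix o o ℝ} (hCt : ∀ x, (C x)ᵀ = -C x) {s : ℝ} (hs : ∀ x, ‖C x‖ ≤ s) (hs1 : s ≤ 1) {τ : ν → Matrix o o ℝ}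
    (hCe : ∀ x, exp (C x) * V = τ x) (h0 : ∑ x, q x • C x = 0) {R' : Matrix o o ℝ} (hR' : R'ᵀ * R' = 1)
    (hsym : ((∑ x, q x • τ x) * R'ᵀ)ᵀ = (∑ x, q x • τ x) * R'ᵀ) (hpsd : ∀ w : o → ℝ, 0 ≤ w ⬝ᵥ (((∑ x, q x • τ x) * R'ᵀ) *ᵥ w)) :
    ‖R' - V‖ ≤ 5 / 2 * s ^ 3 + 49 * s ^ 4 := by
  have e := wsum_congr_of_logs (q := q) hCe
  rw [e] at hsym hpsd
  exact frob_norm_polar_sub_base_le hq hq1 hCt hs hs1 h0 hV hR' hsym hpsd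

omit [Fintype o] [DecidableEq o] [Fintype ν] in
/-- arithmetic: `(5∕2)(8D)³ + 49(8D)⁴ = 1280D³ + 200704D⁴`. -/
theorem eight_mul_cube_eq (D : ℝ) : 5 / 2 * (8 * D) ^ 3 + 49 * (8 * D) ^ 4 = 1280 * D ^ 3 + 200704 * D ^ 4 := by ring

/-- **`karcher_base_of_transports` — THE (1.27)∕(1.29) LINK FROM THE TRANSPORTS, AND (1.26) AGAINST IT** [our proof]: `q ≥ 0`, `Σq = 1`, orthogonal `τ_x`,
`τ₀` with `‖τ_x·τ₀ᵀ − 1‖ ≤ D ≤ 1∕200` ⟹ there is an orthogonal Karcher base `V` (`‖V·τ₀ᵀ − 1‖ ≤ 8D`, skew logarithms `exp(C_x)·V = τ_x` with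
`‖C_x‖ ≤ 8D` and `Σ_x q_x•C_x = 0`) such that EVERY polar link `R′` of `Σ_x q_x•τ_x` satisfies `‖R′ − V‖ ≤ 1280D³ + 200704D⁴` — third order in the loop
letter. -/
theorem karcher_base_of_transports {q : ν → ℝ} (hq : ∀ x, 0 ≤ q x) (hq1 : ∑ x, q x = 1) {τ : ν → Matrix o o ℝ} {τ₀ : Matrix o o ℝ}
    (hτ : ∀ x, (τ x)ᵀ * τ x = 1) (hτ₀ : τ₀ᵀ * τ₀ = 1) {D : ℝ} (hD : ∀ x, ‖τ x * τ₀ᵀ - 1‖ ≤ D) (hD200 : D ≤ 1 / 200) :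
    ∃ (V : Matrix o o ℝ) (C : ν → Matrix o o ℝ), Vᵀ * V = 1 ∧ ‖V * τ₀ᵀ - 1‖ ≤ 8 * D ∧ (∀ x, (C x)ᵀ = -C x) ∧
      (∀ x, exp (C x) * V = τ x) ∧ (∀ x, ‖C x‖ ≤ 8 * D) ∧ ∑ x, q x • C x = 0 ∧
      ∀ R' : Matrix o o ℝ, R'ᵀ * R' = 1 → ((∑ x, q x • τ x) * R'ᵀ)ᵀ = (∑ x, q x • τ x) * R'ᵀ →
        (∀ w : o → ℝ, 0 ≤ w ⬝ᵥ (((∑ x, q x • τ x) * R'ᵀ) *ᵥ w)) → ‖R' - V‖ ≤ 1280 * D ^ 3 + 200704 * D ^ 4 := by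
  obtain ⟨V, C, hV, hV1, hCt, hCe, hC8, h0⟩ := exists_karcher_base_of_transports hq hq1 hτ hτ₀ hD hD200
  refine ⟨V, C, hV, hV1, hCt, hCe, hC8, h0, fun R' hR' hsym hpsd => ?_⟩
  have h := frob_norm_polar_sub_karcher_le hq hq1 hV hCt hC8 (by linarith) hCe h0 hR' hsym hpsd
  rwa [eight_mul_cube_eq] at h

/-- **`exists_polar_near_karcher` — A POLAR LINK EXISTS, and ALL THREE PRINTED CONVENTIONS AGREE TO THIRD ORDER** [our proof; PART 68 ∕ 70]: under the same
hypotheses there are skew logarithms `A_x` at `τ₀` (`exp(A_x)·τ₀ = τ_x`, `‖A_x‖ ≤ 2D`), a polar link `R′`, and a Karcher base `V` with its logarithms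
`C_x` as above, with `‖R′ − exp(Σ_x q_x•A_x)·τ₀‖ ≤ 20D³ + 784D⁴` ((1.26) vs (1.28)), `‖R′ − V‖ ≤ 1280D³ + 200704D⁴` ((1.26) vs (1.27)) and hence
`‖exp(Σ_x q_x•A_x)·τ₀ − V‖ ≤ 1300D³ + 201488D⁴` ((1.28) vs (1.27)). -/
theorem exists_polar_near_karcher {q : ν → ℝ} (hq : ∀ x, 0 ≤ q x) (hq1 : ∑ x, q x = 1) {τ : ν → Matrix o o ℝ} {τ₀ : Matrix o o ℝ}
    (hτ : ∀ x, (τ x)ᵀ * τ x = 1) (hτ₀ : τ₀ᵀ * τ₀ = 1) {D : ℝ} (hD : ∀ x, ‖τ x * τ₀ᵀ - 1‖ ≤ D) (hD200 : D ≤ 1 / 200) :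
    ∃ (A : ν → Matrix o o ℝ) (R' V : Matrix o o ℝ) (C : ν → Matrix o o ℝ), (∀ x, (A x)ᵀ = -A x) ∧ (∀ x, exp (A x) * τ₀ = τ x) ∧
      (∀ x, ‖A x‖ ≤ 2 * D) ∧ R'ᵀ * R' = 1 ∧ ((∑ x, q x • τ x) * R'ᵀ)ᵀ = (∑ x, q x • τ x) * R'ᵀ ∧
      (∀ w : o → ℝ, 0 ≤ w ⬝ᵥ (((∑ x, q x • τ x) * R'ᵀ) *ᵥ w)) ∧ Vᵀ * V = 1 ∧ (∀ x, (C x)ᵀ = -C x) ∧ (∀ x, exp (C x) * V = τ x) ∧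
      (∀ x, ‖C x‖ ≤ 8 * D) ∧ ∑ x, q x • C x = 0 ∧
      ‖R' - exp (∑ x, q x • A x) * τ₀‖ ≤ 20 * D ^ 3 + 784 * D ^ 4 ∧ ‖R' - V‖ ≤ 1280 * D ^ 3 + 200704 * D ^ 4 ∧
      ‖exp (∑ x, q x • A x) * τ₀ - V‖ ≤ 1300 * D ^ 3 + 201488 * D ^ 4 := by
  obtain ⟨A, R', hAt, hAe, hA2, hR', hsym, hpsd, hb⟩ := exists_polar_and_expMeanLink_of_transports hq hq1 hτ hτ₀ hD (by linarith)
  obtain ⟨V, C, hV, -, hCt, hCe, hC8, h0, hpol⟩ := karcher_base_of_transports hq hq1 hτ hτ₀ hD hD200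
  have hRV := hpol R' hR' hsym hpsd
  refine ⟨A, R', V, C, hAt, hAe, hA2, hR', hsym, hpsd, hV, hCt, hCe, hC8, h0, hb, hRV, ?_⟩
  calc ‖exp (∑ x, q x • A x) * τ₀ - V‖ = ‖(R' - V) - (R' - exp (∑ x, q x • A x) * τ₀)‖ := by congr 1; abel
    _ ≤ ‖R' - V‖ + ‖R' - exp (∑ x, q x • A x) * τ₀‖ := norm_sub_le _ _
    _ ≤ (1280 * D ^ 3 + 200704 * D ^ 4) + (20 * D ^ 3 + 784 * D ^ 4) := add_le_add hRV hb
    _ = 1300 * D ^ 3 + 201488 * D ^ 4 := by ring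

/-! ## §5 PART 56's transfer letter for the (1.27) pair -/

/-- **`transferLetter_karcher_of_transports` — THE BOND-INDEXED LETTER, PART 56's `hτ` FOR THE (1.27)∕(1.29) LINK** [our proof]: for every coarse bond `e′`
let orthogonal open transports `τ(e′,x)` and a reference `τ₀(e′)` have loops within `D ≤ 1∕200`; then there are Karcher bases `V(e′)` (orthogonal; skew
logarithms `exp(C(e′,x))·V(e′) = τ(e′,x)` of size `≤ 8D` with `Σ_x q(src′e′,x)•C(e′,x) = 0`) such that for EVERY family of polar links `R′(e′)`:
`|(V(e′) − R′(e′))w|² ≤ (1280D³ + 200704D⁴)²·|w|²`. -/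
theorem transferLetter_karcher_of_transports {μ β' : Type*} {q : μ → ν → ℝ} (hq : ∀ y x, 0 ≤ q y x) (hq1 : ∀ y, ∑ x, q y x = 1)
    {src' : β' → μ} {τ : β' → ν → Matrix o o ℝ} {τ₀ : β' → Matrix o o ℝ} (hτ : ∀ e' x, (τ e' x)ᵀ * τ e' x = 1)
    (hτ₀ : ∀ e', (τ₀ e')ᵀ * τ₀ e' = 1) {D : ℝ} (hD : ∀ e' x, ‖τ e' x * (τ₀ e')ᵀ - 1‖ ≤ D) (hD200 : D ≤ 1 / 200) :
    ∃ (V : β' → Matrix o o ℝ) (C : β' → ν → Matrix o o ℝ), (∀ e', (V e')ᵀ * V e' = 1) ∧ (∀ e' x, (C e' x)ᵀ = -C e' x) ∧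
      (∀ e' x, exp (C e' x) * V e' = τ e' x) ∧ (∀ e' x, ‖C e' x‖ ≤ 8 * D) ∧ (∀ e', ∑ x, q (src' e') x • C e' x = 0) ∧
      ∀ R' : β' → Matrix o o ℝ, (∀ e', (R' e')ᵀ * R' e' = 1) →
        (∀ e', ((∑ x, q (src' e') x • τ e' x) * (R' e')ᵀ)ᵀ = (∑ x, q (src' e') x • τ e' x) * (R' e')ᵀ) →
        (∀ e' (w : o → ℝ), 0 ≤ w ⬝ᵥ (((∑ x, q (src' e') x • τ e' x) * (R' e')ᵀ) *ᵥ w)) →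
        ∀ e' (w : o → ℝ), ((V e' - R' e') *ᵥ w) ⬝ᵥ ((V e' - R' e') *ᵥ w) ≤ (1280 * D ^ 3 + 200704 * D ^ 4) ^ 2 * (w ⬝ᵥ w) := by
  have h : ∀ e', ∃ (Ve : Matrix o o ℝ) (Ce : ν → Matrix o o ℝ), Veᵀ * Ve = 1 ∧ ‖Ve * (τ₀ e')ᵀ - 1‖ ≤ 8 * D ∧ (∀ x, (Ce x)ᵀ = -Ce x) ∧
      (∀ x, exp (Ce x) * Ve = τ e' x) ∧ (∀ x, ‖Ce x‖ ≤ 8 * D) ∧ ∑ x, q (src' e') x • Ce x = 0 ∧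
      ∀ R' : Matrix o o ℝ, R'ᵀ * R' = 1 → ((∑ x, q (src' e') x • τ e' x) * R'ᵀ)ᵀ = (∑ x, q (src' e') x • τ e' x) * R'ᵀ →
        (∀ w : o → ℝ, 0 ≤ w ⬝ᵥ (((∑ x, q (src' e') x • τ e' x) * R'ᵀ) *ᵥ w)) → ‖R' - Ve‖ ≤ 1280 * D ^ 3 + 200704 * D ^ 4 :=
    fun e' => karcher_base_of_transports (hq (src' e')) (hq1 (src' e')) (hτ e') (hτ₀ e') (hD e') hD200
  choose V C hV hV1 hCt hCe hC8 h0 hpol using h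
  refine ⟨V, C, hV, hCt, hCe, hC8, h0, fun R' hR' hsym hpsd e' w => ?_⟩
  have hb := hpol e' (R' e') (hR' e') (hsym e') (hpsd e')
  rw [← norm_neg, neg_sub] at hb
  refine (mulVec_dotProduct_self_le_frob _ w).trans (mul_le_mul_of_nonneg_right (pow_le_pow_left₀ (norm_nonneg _) hb 2) ?_)
  simpa only [dotProduct] using Finset.sum_nonneg fun i _ => mul_self_nonneg (w i)

end Summit.QuantumFields.BalabanUV.Beta.GAN24.DerivativeRateTransferJensenMassFreeKarcherEquation

end
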